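import Summits.BirchSwinnertonDyer.Rank1Residual.X4.VisibilityRankOneFreePlaces
import Summits.BirchSwinnertonDyer.Rank1Residual.X11b.ChaPairsMinimality
import Summits.BirchSwinnertonDyer.BirchSwinnertonDyer.Theorems.Rank1ResidualIntModelSurjectivity
import Summits.BirchSwinnertonDyer.BirchSwinnertonDyer.Theorems.Rank1ResidualX11RankOneMinimality
import Summits.BirchSwinnertonDyer.BirchSwinnertonDyer.Theorems.Rank1ResidualX11RankOneReduction
import Summits.BirchSwinnertonDyer.BirchSwinnertonDyer.Theorems.Rank2ObservatoryRank3KernelCerts779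
import Summits.BirchSwinnertonDyer.Rank1Residual.GaloisImage.LocalTorsionAwayFromPAdicCompletion
import Literature.NumberTheory.EllipticCurves.PointCountEulerCriterion
import Literature.NumberTheory.GaloisRepresentations.LocalH2VanishingTrivialModule
import Literature.NumberTheory.GaloisRepresentations.TateLevelOneLocalGenerators
import HarnessLib

/-!
# BSD rank-≤1 residual cell, class X4 (additive at `p = 5`): `BSD(E,5)` for `377600dn1` (`#Ш_an = 25`,
# rank one, `ρ̄_{E,5}` onto) from PUBLISHED theorems + a two-engine certificate — Kolyvagin upper half,
# VISIBILITY lower half with the multiplicative place `59` FREE (kind (iii′)) and the rank-`3` partner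
# `377600a1` certified IN THE KERNEL

HONEST FRAMING (cell `b2b-bsdres-*`, verbatim): prove what is provable now; shrink each hard class
to its core with data; no claim beyond stated classes; COMBINATION classes deleted from PUBLISHED
theorems only, CONSTRUCTION-shaped remainder typed; this is not "finishing BSD". Class X4 stays
CONSTRUCTION-SHAPED; everything here is PER PAIR; no lane verdict is changed; no named fact; nothing
is booked by this unit.

Unit `b2b-bsdres-x11c`, GEN 25 (prover-b2b-bsdres-x11c-g25-0). `377600dn1@5` is the ONE row of the
unit's exploratory full-`5`-descent campaign on the 702 rank-one X4 pairs with surjective mod-`5` image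
(`X4/FullDescentRecordsRankOne01–59`) that the campaign's kernel consumer cannot take (`#Ш_an = 25`; the
descent row reads `dim Fake = 3`, UNDETERMINED). `E = [0,-1,0,-861918783,9740033309387]`,
`N = 377600 = 2⁸·5²·59`, `Δ_min = -2⁹·5⁴·59`, Kodaira `III`, `IV`, `I₁` (non-split) at `2, 5, 59`,
`∏ c_q = 2`, `E(ℚ)_tors = 0`, generator `(152554/9, 1/27)`, `r_an = 1`, `#Ш_an = 25` (Cremona). Gen 4's
rank-one visibility route (`X11b/VisibilityRankOne.lean`, pair `403280bd1`) closes it PER PAIR with two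
differences: the partner's rank `3` is a KERNEL theorem of the tree (rank-≥2 observatory), and the
multiplicative place `59` — both curves NON-SPLIT there, so `#Ẽ'_ns(𝔽₅₉) = 60` and `E'(ℚ₅₉)[5] ≠ 0`,
which the simple count cannot afford — is FREE by the twisted-Tate comparison (kind (iii′) of the
cell's `GaloisImage/CongruenceVisibilityPotMult.lean`; binder `hU2` = Tate uniformisation, as in every
multiplicative-place visibility record of the cell).

* UPPER half (Kolyvagin via McCallum 1991 §1 / Gross 1991 Thm. 1.3 (2); named facts `kolyvagin`,
  `Kolyvagin1990_padicValNat_card_sha_le`): `K = ℚ(√-31)` (`2, 5, 59` split; `5 ∤ 31`), `y_K` of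
  infinite order, `m = √(4ρ) = 20`, `ord₅ m = 1` (Miller 2011 Thm. 4.1 / Cor. 4.8 normalisation:
  `ρ = L'(E,1)·L(E^D,1)·√31 / (4·Area(E)·ĥ(x)) = 100`; `L'(E,1) = 15.4340731828688…` and
  `ĥ(x) = 1.2301661542…` = Cremona's values, `L(E^{-31},1) = 0.01000880244406…`) — engine 1 (cypari2,
  gen 3's `engine1_cha1b/main.py` verbatim, kit j222598) = engine B (PARI/GP `certB_377600dn1.gp`, kit
  j222591, 57 digits) = engine 2 (stdlib python, gen 3's `engine2` verbatim, kit j223379); hence `ord₅ [E(K) : ℤ y_K] ≤ 1` and `ord₅ #Ш(E/ℚ) ≤ 2`.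
* LOWER half (KERNEL count `exists_sha_ne_zero_of_congr_of_relIndex_lt`, Cremona–Mazur 2000 §3 /
  Agashe–Stein 2002 Thm. 3.1, with comparison indices; Cassels–Tate, bsd.S18): `E' = 377600a1 =
  [0,0,0,50,1600]` (same conductor; Kodaira `III`, `IV`, `I₂` (non-split), `c_q = 2, 3, 2`; no torsion)
  has `rank E'(ℚ) ≥ 3` IN THE KERNEL (`Rank2Observatory.Rank3KernelCerts779.C377600a1.three_le_rank`)
  and is `5`-CONGRUENT to `E`: `a_ℓ(E) ≡ a_ℓ(E') (mod 5)` for all `ℓ ≤ 115200 = μ(377600)/6`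
  (`a_2 = a_5 = 0`, `a_59 = -1` for both; engine A python point counting, kit j222590: 10888 primes, none
  non-congruent = engine B PARI `ellan`, all `a_n`), so `E[5] ≅ E'[5]` (Kraus–Oesterlé 1992 Prop. 4, `M = N`;
  `E[5]` irreducible). Places: `E'(ℚ₂)[5] = 0` (additive `III`, `c₂ = 2`; `ψ₅` has no root mod `2⁷`);
  `E'(ℚ₅)[5] = 0` (type `IV` is tame, `e = 3 < 4`: good supersingular reduction `y² = x³ + 4` over
  `ℚ₅(5^{1/3})`, `#Ẽ'(𝔽₅) = 6`; PARI: no `5`-adic root of `ψ₅` with `y ∈ ℚ₅`); at `59`, IN THE KERNEL: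
  `59 ∣ den j` twice, `γ(E) = r² γ(E')` in `ℚ₅₉` (`γ = -c₄/c₆`; `γ(E)/γ(E') = -1861744572/657432855211`, a
  `59`-unit and a square mod `59`) and `μ₅(ℚ₅₉) = 1` (`5 ∤ 59·58`). Count: `[E(ℚ):5E(ℚ)]·ι₂·ι₅·ι₅₉ ≤
  5·1·5·1 = 25 < 125 ≤ [E'(ℚ):5E'(ℚ)]`, so `Ш(E)[5] ≠ 0`, `25 ∣ #Ш(E/ℚ)`, `ord₅ #Ш(E/ℚ) = 2 = ord₅ #Ш_an`.

KERNEL (this file): `Δ ≠ 0` twice, minimality of `E`, `ρ̄_{E,5}` ONTO (Serre Prop. 19 witnesses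
`ℓ = 7` (`a = 3`), `ℓ = 3` (`a = 2`), `ℓ = 3`; counts `#Ẽ(𝔽₇) = 5`, `#Ẽ(𝔽₃) = 2`), good reduction outside
`S = {2, 5, 59}`, `rank E' ≥ 3`, `E'(ℚ₂)[5] = 0` (local Tamagawa certificate), the kind-(iii′) numerals at `59`.
BINDERS: `hCT`, `hGZK`, `hKo`, `hB`,
`hU2`; the Heegner datum (`K`, `N`, `P`, `ord₅ [E(K):ℤP] ≤ 1`); `r_an = 1`; `#Ш_an = s`, `ord₅ s = 2`;
`θ : E'[5] ≃ E[5]`; `E'(ℚ₅)[5] = 0`. Evidence: HOME/b2b-bsdres-x11c/gen25/vis377600/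
(engines A, B, 1, 2; `CERT-377600dn1.md`), REPORT.md §35. Lane books the verdict; no label changes.

References: [CremonaMazur2000] §3; [AgasheStein2002] Thm. 3.1; [KrausOesterle1992] Prop. 4;
[McCallumLMS1991] §1; [GrossLMS1991] Thm. 1.3; [Serre1972] §2.8 Prop. 19; [SilvermanAEC2009] VII.1,
X.4.14; [SilvermanATAEC1994] V.5.3; [Miller2011LMS] Def. 1.1, Thm. 4.1, Cor. 4.8; [NeukirchANT1999]
II (5.3); [Cremona2006].
-/

set_option autoImplicit false

noncomputable section

open scoped Classical

open WeierstrassCurve Literature.NumberTheory.EllipticCurves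
  Literature.NumberTheory.EllipticCurves.Rank1Residual
  Literature.NumberTheory.EllipticCurves.Rank1Residual.Typed
  Literature.NumberTheory.EllipticCurves.Rank1Residual.X11RankOneCertificates
  Summit.BirchSwinnertonDyer.BirchSwinnertonDyer.Rank1Residual.IntModel
  Summit.BirchSwinnertonDyer.BirchSwinnertonDyer.Rank1Residual.X11RankOne
  Summit.BirchSwinnertonDyer.BirchSwinnertonDyer.Rank2Observatory
  Summit.BirchSwinnertonDyer.BirchSwinnertonDyer.Rank2Observatory.Tam
  Summit.BirchSwinnertonDyer.Rank1Residual.GaloisImage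
open NumberField IsDedekindDomain

namespace Summit.BirchSwinnertonDyer.Rank1Residual.X4

/-! ### §1. Kernel point counts and surjectivity of `ρ̄_{E,5}` for `377600dn1` -/

/-- `#Ẽ(𝔽₃) = 2` (`a_3 = 2`) for Cremona's model `377600dn1`. [folklore] -/
theorem card_v377600dn1_3 :
    Nat.card (((⟨0, -1, 0, -861918783, 9740033309387⟩ : WeierstrassCurve ℤ).map
      (Int.castRingHom (ZMod 3))).toAffine.Point) = 2 := by
  rw [@WeierstrassCurve.natCard_point_eq_one_add_card (ZMod 3) (@ZMod.instField 3 ⟨by norm_num⟩) _ _ _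
    (by decide +kernel), @card_sol_eq_sum_euler (ZMod 3) (@ZMod.instField 3 ⟨by norm_num⟩) _ _
    (by rw [ZMod.ringChar_zmod_n]; decide), ZMod.card]
  decide +kernel

/-- `#Ẽ(𝔽₇) = 5` (`a_7 = 3`) for Cremona's model `377600dn1`. [folklore] -/
theorem card_v377600dn1_7 :
    Nat.card (((⟨0, -1, 0, -861918783, 9740033309387⟩ : WeierstrassCurve ℤ).map
      (Int.castRingHom (ZMod 7))).toAffine.Point) = 5 := by
  rw [@WeierstrassCurve.natCard_point_eq_one_add_card (ZMod 7) (@ZMod.instField 7 ⟨by norm_num⟩) _ _ _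
    (by decide +kernel), @card_sol_eq_sum_euler (ZMod 7) (@ZMod.instField 7 ⟨by norm_num⟩) _ _
    (by rw [ZMod.ringChar_zmod_n]; decide), ZMod.card]
  decide +kernel

/-- **`ρ̄_{E,5}` is onto for `377600dn1`** (Serre witnesses mod `5`: `ℓ = 7`, `a_7 = 3`
(`a² - 4ℓ = -19 ≡ 1`, a non-zero square: split Cartan excluded); `ℓ = 3`, `a_3 = 2` (`a² - 4ℓ = -8 ≡ 2`,
a non-square: non-split Cartan excluded); `ℓ = 3` (`u = a²/ℓ = 4·2 ≡ 3 ∉ {0,1,2,4}`, `u²-3u+1 ≡ 1 ≠ 0`: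
exceptional images excluded); Prop. 19 ⇒ `G ⊇ SL₂(𝔽₅)`, `det = χ₅` onto), for any globally minimal
elliptic `W/ℚ` with this integral model. Both engines find these witnesses (engine A `certA.py` C5,
engine B `certB_377600dn1.gp` C5); the kernel re-verifies the point counts. [cite: Serre1972, §2.8 Prop. 19] -/
theorem surj_v377600dn1 {W : WeierstrassCurve ℚ} [W.IsElliptic] [W.IsGloballyMinimal]
    (hI : integralModelInt W = ⟨0, -1, 0, -861918783, 9740033309387⟩) :
    W.HasSurjectiveModNGaloisRep 5 :=
  @hasSurjectiveModNGaloisRep_of_intModel_of_serreWitnesses W _ _ _ hI 5 ⟨by norm_num⟩ (by norm_num)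
    7 3 3 ⟨by norm_num⟩ ⟨by norm_num⟩ ⟨by norm_num⟩ (by decide) (by decide) (by decide)
    (by decide +kernel) (by decide +kernel) (by decide +kernel) _ _ _
    card_v377600dn1_7 card_v377600dn1_3 card_v377600dn1_3
    (by decide +kernel) (by decide +kernel) (by decide +kernel)

/-- The local Tamagawa certificate of the partner `377600a1` at `2` (additive, Kodaira `III`: Step-2 exit `3`
with `v₂(b₈) = 2`, `v₂(Δ) = 9`, `c₂ = 2`) passes the kernel check; with `5 ∤ c₂ · #Ẽ'_ns(𝔽₂) = 2·2` it gives
`E'(ℚ₂)[5] = 0` (`LocalTorsionAway.natCard_ker_nsmul_adicCompletion_eq_one_of_intModel_of_additive_tamLocal_forall`).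
Two engines print the same local data (engine A Tate's algorithm: `III`, `c = 2`; engine B `elllocalred`: `[8, III, ·, 2]`).
[cite: SilvermanATAEC1994, IV.9.4] -/
theorem tamLocal_check_v377600a1_2 :
    TamLocal.check ⟨2, 1, 4, 0, 0, 0, 0, 9, 3, 2, 2⟩ ⟨0, 0, 0, 50, 1600⟩ = true := by
  decide +kernel

/-! ### §2. Good reduction of both models outside `{2, 5, 59}`; the kind-(iii′) numerals at `59` -/

/-- A prime dividing `2^a · 5^b · 59^c` is `2`, `5` or `59`. [folklore] -/
theorem eq_of_prime_dvd_two_five_fiftynine {q a b c : ℕ} (hq : q.Prime)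
    (h : q ∣ 2 ^ a * 5 ^ b * 59 ^ c) : q = 2 ∨ q = 5 ∨ q = 59 := by
  rcases (Nat.Prime.dvd_mul hq).mp h with h25 | h59
  · rcases (Nat.Prime.dvd_mul hq).mp h25 with h2 | h5
    · exact Or.inl ((Nat.prime_dvd_prime_iff_eq hq Nat.prime_two).mp (hq.dvd_of_dvd_pow h2))
    · exact Or.inr (Or.inl ((Nat.prime_dvd_prime_iff_eq hq (by norm_num)).mp (hq.dvd_of_dvd_pow h5)))
  · exact Or.inr (Or.inr ((Nat.prime_dvd_prime_iff_eq hq (by norm_num)).mp (hq.dvd_of_dvd_pow h59)))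

/-- **Outside the places of `2`, `5`, `59` both `377600dn1` and `377600a1` have good reduction and the
place does not contain `5`** (`|Δ(E)| = 2⁹·5⁴·59`, `|Δ(E')| = 2⁹·5⁴·59²`; an integral equation with
`v`-unit discriminant has good reduction, Silverman AEC VII.5 Prop. 5.1(a); tree
`hasGoodReductionAt_map_of_not_dvd`). [cite: SilvermanAEC2009, VII.5 Prop. 5.1(a)] -/
theorem good_outside_v377600 (v : HeightOneSpectrum (𝓞 ℚ))
    (hv : v ∉ ({(Rat.HeightOneSpectrum.primesEquiv (R := 𝓞 ℚ)).symm ⟨2, Nat.prime_two⟩,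
      (Rat.HeightOneSpectrum.primesEquiv (R := 𝓞 ℚ)).symm ⟨5, by norm_num⟩,
      (Rat.HeightOneSpectrum.primesEquiv (R := 𝓞 ℚ)).symm ⟨59, by norm_num⟩} :
        Finset (HeightOneSpectrum (𝓞 ℚ)))) :
    (⟨0, -1, 0, -861918783, 9740033309387⟩ : WeierstrassCurve ℚ).HasGoodReductionAt v ∧
      (⟨0, 0, 0, 50, 1600⟩ : WeierstrassCurve ℚ).HasGoodReductionAt v ∧
      (5 : 𝓞 ℚ) ∉ v.asIdeal := by
  set e := Rat.HeightOneSpectrum.primesEquiv (R := 𝓞 ℚ) with he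
  have hq : (e v : ℕ).Prime := (e v).2
  have hne : ¬ ((e v : ℕ) = 2 ∨ (e v : ℕ) = 5 ∨ (e v : ℕ) = 59) := by
    intro h
    apply hv
    simp only [Finset.mem_insert, Finset.mem_singleton]
    rcases h with h | h | h
    · left; apply e.injective; rw [Equiv.apply_symm_apply]; exact Subtype.ext h
    · right; left; apply e.injective; rw [Equiv.apply_symm_apply]; exact Subtype.ext h
    · right; right; apply e.injective; rw [Equiv.apply_symm_apply]; exact Subtype.ext h
  have hΔE : ¬ ((e v : ℕ) : ℤ) ∣ (⟨0, -1, 0, -861918783, 9740033309387⟩ : WeierstrassCurve ℤ).Δ := by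
    intro h
    rw [intCurve_Δ, Int.natCast_dvd] at h
    have habs : (discOf [0, -1, 0, -861918783, 9740033309387]).natAbs = 2 ^ 9 * 5 ^ 4 * 59 ^ 1 := by
      decide +kernel
    exact hne (eq_of_prime_dvd_two_five_fiftynine hq (habs ▸ h))
  have hΔF : ¬ ((e v : ℕ) : ℤ) ∣ (⟨0, 0, 0, 50, 1600⟩ : WeierstrassCurve ℤ).Δ := by
    intro h
    rw [intCurve_Δ, Int.natCast_dvd] at h
    have habs : (discOf [0, 0, 0, 50, 1600]).natAbs = 2 ^ 9 * 5 ^ 4 * 59 ^ 2 := by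
      decide +kernel
    exact hne (eq_of_prime_dvd_two_five_fiftynine hq (habs ▸ h))
  refine ⟨?_, ?_, fun h5 ↦ hne (Or.inr (Or.inl
    (Rat.HeightOneSpectrum.primesEquiv_eq_of_natCast_mem v (by norm_num) h5)))⟩
  · have h := hasGoodReductionAt_map_of_not_dvd _ v hΔE
    exact (map_mk_int 0 (-1) 0 (-861918783) 9740033309387) ▸ h
  · have h := hasGoodReductionAt_map_of_not_dvd _ v hΔF
    exact (map_mk_int 0 0 0 50 1600) ▸ h

/-- **Kind (iii′) at the place of `59` for `377600dn1 ~ 377600a1`, `p = 5`, in the kernel**: both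
`j`-invariants have `59 ∣ den` (`j(E) = -221295595064774497205412800/59`, `j(E') = 43200/3481`: both
curves are (non-split) multiplicative at `59`), the twist classes agree in `ℚ₅₉`
(`γ(E)/γ(E') = -1861744572/657432855211` with `γ = -c₄/c₆`, a `59`-adic unit which is a square mod `59`:
`sqFlagAt 59 (N·D) 0 = true`), and `μ₅(ℚ₅₉) = 1` (`5 ∤ 59`, `5 ∤ 58`; Neukirch ANT II (5.3)). Two
engines print the same numerals (engine A C8, engine B C8). [cite: SilvermanATAEC1994, Ch. V Lemma 5.2 (c),
Thm. 5.3, Cor. 5.4] [cite: NeukirchANT1999, II §5 Prop. (5.3) and (5.7)] -/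
theorem kindIIIPrime_v377600_at59 (W W' : WeierstrassCurve ℚ) [W.IsElliptic] [W'.IsElliptic]
    (hW : W = ⟨0, -1, 0, -861918783, 9740033309387⟩) (hW' : W' = ⟨0, 0, 0, 50, 1600⟩)
    {v : HeightOneSpectrum (𝓞 ℚ)} (hv : (Rat.HeightOneSpectrum.primesEquiv v : ℕ) = 59) :
    1 < v.valuation ℚ W.j ∧ 1 < v.valuation ℚ W'.j ∧
      (∃ r : v.adicCompletion ℚ, algebraMap ℚ (v.adicCompletion ℚ) (-(W.c₄ / W.c₆)) =
        r ^ 2 * algebraMap ℚ (v.adicCompletion ℚ) (-(W'.c₄ / W'.c₆))) ∧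
      (∀ ζ : v.adicCompletion ℚ, ζ ^ 5 = 1 → ζ = 1) := by
  haveI : Fact (Nat.Prime 59) := ⟨by norm_num⟩
  haveI : Fact (Nat.Prime 5) := ⟨by norm_num⟩
  have hj : W.j = -221295595064774497205412800 / 59 := by
    rw [WeierstrassCurve.j_eq_c₄_pow_three_div_Δ]; subst hW
    norm_num [WeierstrassCurve.c₄, WeierstrassCurve.Δ, WeierstrassCurve.b₂, WeierstrassCurve.b₄,
      WeierstrassCurve.b₆, WeierstrassCurve.b₈]
  have hj' : W'.j = 43200 / 3481 := by
    rw [WeierstrassCurve.j_eq_c₄_pow_three_div_Δ]; subst hW'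
    norm_num [WeierstrassCurve.c₄, WeierstrassCurve.Δ, WeierstrassCurve.b₂, WeierstrassCurve.b₄,
      WeierstrassCurve.b₆, WeierstrassCurve.b₈]
  have hA : -(W.c₄ / W.c₆) = 51715127 / 10518925683376 := by
    subst hW
    norm_num [WeierstrassCurve.c₄, WeierstrassCurve.c₆, WeierstrassCurve.b₂, WeierstrassCurve.b₄,
      WeierstrassCurve.b₆]
  have hB : -(W'.c₄ / W'.c₆) = -1 / 576 := by
    subst hW'
    norm_num [WeierstrassCurve.c₄, WeierstrassCurve.c₆, WeierstrassCurve.b₂, WeierstrassCurve.b₄,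
      WeierstrassCurve.b₆]
  refine ⟨TwistedKummer.one_lt_valuation_of_eq_of_dvd_den v hv hj (by norm_num) (by decide +kernel),
    TwistedKummer.one_lt_valuation_of_eq_of_dvd_den v hv hj' (by norm_num) (by decide +kernel), ?_, ?_⟩
  · rw [hA, hB]
    exact LocalTorsion3At.exists_eq_sq_mul_of_sqFlagAt v hv (by norm_num) (D := 657432855211)
      (by norm_num) (N := -1861744572) (by norm_num) (w := 0) (by norm_num) (by decide +kernel)
      (by decide +kernel)
  · have hcard : Literature.NumberTheory.GaloisRepresentations.IsNonarchimedeanLocalField.residueFieldCard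
        (v.adicCompletion ℚ) = 59 :=
      Literature.NumberTheory.GaloisRepresentations.residueFieldCard_adicCompletion_rat 59 v hv
    exact Literature.NumberTheory.GaloisRepresentations.forall_pow_eq_one_imp_eq_one_of_not_dvd
      (F := v.adicCompletion ℚ) (p := 5) (by rw [hcard]; norm_num) (by rw [hcard]; norm_num)

/-! ### §3. `BSD(E,5)` for `377600dn1` -/

/-- **`BSD(E,5)` for `377600dn1`** (`N = 377600 = 2⁸·5²·59`; `ρ̄_{E,5}` onto, additive at `5` (Kodaira
`IV`) and at `2` (`III`), non-split multiplicative at `59`, `∏ c_q = 2`, `r_an = 1`, `#Ш_an = 25`; class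
X4, the one UNDETERMINED row of the x5desc campaign) from PUBLISHED theorems — Kolyvagin's index bound
(`hKo`, `hB`: McCallum 1991 §1 / Gross 1991 Thm. 1.3), Cassels–Tate (`hCT`), Gross–Zagier–Kolyvagin
(`hGZK`), Tate's uniformisation (`hU2`) — plus TWO per-pair certificates: the Heegner datum
`K = ℚ(√-31)`, `ord₅ [E(K) : ℤ y_K] ≤ 1` (`m = 20`; engines 1 / B / 2 = kit j222598 / j222591 / j223379) for the
UPPER half,
and the `5`-congruent RANK-3 partner `W' = 377600a1` (`θ : E'[5] ≃ E[5]`, from the two-engine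
Sturm/Kraus–Oesterlé congruence to `115200` and irreducibility of `E[5]`; `E'(ℚ₅)[5] = 0`: the tame cubic
extension at `5` / `ψ₅` roots) for the LOWER half. KERNEL: `Δ ≠ 0` for
both models, global minimality of `W`, `ρ̄_{E,5}` onto (`surj_v377600dn1`), `S = {2,5,59}` with good
reduction outside (`good_outside_v377600`), `rank E'(ℚ) ≥ 3`
(`Rank2Observatory.Rank3KernelCerts779.C377600a1.three_le_rank`), `E'(ℚ₂)[5] = 0` (`tamLocal_check_v377600a1_2`),
and the place `59` FREE by kind (iii′) (`kindIIIPrime_v377600_at59`); the one local BINDER left is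
`E'(ℚ₅)[5] = 0` (`hloc5`: additive `IV` at `p` itself). Per pair; lane books the verdict; no label change.
[cite: McCallumLMS1991, §1 Theorem (Kolyvagin), p. 296] [cite: SilvermanAEC2009, Thm. X.4.14]
[cite: CremonaMazur2000, §3 and Table 1] [cite: KrausOesterle1992, Prop. 4]
[cite: SilvermanATAEC1994, Ch. V Thm. 5.3, Cor. 5.4] [cite: Miller2011LMS, Def. 1.1, Thm. 4.1, Cor. 4.8]
[cite: Cremona2006, Table 1 (labels 377600dn1, 377600a1)] -/
theorem bsdp_v377600dn1 (hCT : exists_casselsTate_pairing (K := ℚ))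
    (hGZK : rank_eq_analyticRank_of_analyticRank_le_one)
    (hU2 : Silverman1994_thmV53_corV54_tateUniformisation.{0})
    (W : WeierstrassCurve ℚ) (hW : W = ⟨0, -1, 0, -861918783, 9740033309387⟩)
    {N : ℕ} [NeZero N] {K : Type} [Field K] [NumberField K] (hKo : kolyvagin N W K)
    (hB : Kolyvagin1990_padicValNat_card_sha_le N W K) (hK : IsImaginaryQuadratic K)
    (hH : SatisfiesHeegnerHypothesis N K) {P : (W.baseChange K).toAffine.Point}
    (hP : IsHeegnerPoint N W K P) (hnt : ¬ IsOfFinAddOrder P)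
    (hI : padicValNat 5 (AddSubgroup.zmultiples P).index ≤ 1)
    (hr : W.analyticRank = 1) {s : ℚ} (hs : shaAn W = (s : ℂ)) (hv : padicValRat 5 s = 2)
    (W' : WeierstrassCurve ℚ) (hW' : W' = ⟨0, 0, 0, 50, 1600⟩)
    (θ : geomTorsion W' (5 : ℕ) ≃+ geomTorsion W (5 : ℕ))
    (hθ : ∀ (σ : Field.absoluteGaloisGroup ℚ) (Q : geomTorsion W' (5 : ℕ)), θ (σ • Q) = σ • θ Q)
    (hloc5 : ∀ v : HeightOneSpectrum (𝓞 ℚ), (Rat.HeightOneSpectrum.primesEquiv v : ℕ) = 5 →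
      Nat.card (nsmulAddMonoidHom 5 : (W'.baseChange (v.adicCompletion ℚ)).toAffine.Point →+ _).ker = 1) :
    BSDp W 5 := by
  -- instances for the literal models
  haveI hE : (⟨0, -1, 0, -861918783, 9740033309387⟩ : WeierstrassCurve ℚ).IsElliptic :=
    X11b.isElliptic_of_discOf_ne_zero 0 (-1) 0 (-861918783) 9740033309387 (by decide +kernel)
  haveI hE' : (⟨0, 0, 0, 50, 1600⟩ : WeierstrassCurve ℚ).IsElliptic :=
    X11b.isElliptic_of_discOf_ne_zero 0 0 0 50 1600 (by decide +kernel)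
  -- the partner's rank, a KERNEL theorem of the rank-≥2 observatory (stated there on the `ℤ`-model)
  have hrank : 3 ≤ W'.mordellWeilRank := by
    have h3 := Summit.BirchSwinnertonDyer.BirchSwinnertonDyer.Rank2Observatory.Rank3KernelCerts779.C377600a1.three_le_rank
    have hE : (⟨0, 0, 0, 50, 1600⟩ : WeierstrassCurve ℤ).map (Int.castRingHom ℚ) =
        (⟨0, 0, 0, 50, 1600⟩ : WeierstrassCurve ℚ) := by
      ext <;> simp [WeierstrassCurve.map]
    rw [hE] at h3
    subst hW'
    exact h3
  subst hW hW'
  haveI hM : (⟨0, -1, 0, -861918783, 9740033309387⟩ : WeierstrassCurve ℚ).IsGloballyMinimal :=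
    isGloballyMinimal_of_krausCriterion_bounded 0 (-1) 0 (-861918783) 9740033309387
      (by decide +kernel) (by decide +kernel) (by decide +kernel)
  haveI hM' : (⟨0, 0, 0, 50, 1600⟩ : WeierstrassCurve ℚ).IsGloballyMinimal :=
    isGloballyMinimal_of_krausCriterion_bounded 0 0 0 50 1600
      (by decide +kernel) (by decide +kernel) (by decide +kernel)
  have hI' : integralModelInt (⟨0, 0, 0, 50, 1600⟩ : WeierstrassCurve ℚ) = ⟨0, 0, 0, 50, 1600⟩ :=
    integralModelInt_eq_of_map_eq _ (map_mk_int 0 0 0 50 1600)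
  haveI : Fact (Nat.Prime 5) := ⟨by norm_num⟩
  haveI : Fact (Nat.Prime 2) := ⟨by norm_num⟩
  have hρ : (⟨0, -1, 0, -861918783, 9740033309387⟩ : WeierstrassCurve ℚ).HasSurjectiveModNGaloisRep 5 :=
    surj_v377600dn1 (integralModelInt_eq_of_map_eq _ (map_mk_int 0 (-1) 0 (-861918783) 9740033309387))
  refine bsdp_of_kolyvagin_of_congr_of_freePlaces _ 5 hCT hGZK hKo hB hK hH hP hnt hU2 (by norm_num) hρ
    hI hr hs hv _ θ hθ hrank
    ({(Rat.HeightOneSpectrum.primesEquiv (R := 𝓞 ℚ)).symm ⟨2, Nat.prime_two⟩,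
      (Rat.HeightOneSpectrum.primesEquiv (R := 𝓞 ℚ)).symm ⟨5, by norm_num⟩,
      (Rat.HeightOneSpectrum.primesEquiv (R := 𝓞 ℚ)).symm ⟨59, by norm_num⟩} :
        Finset (HeightOneSpectrum (𝓞 ℚ)))
    (fun v hv' ↦ good_outside_v377600 v hv') fun v hvS ↦ ?_
  -- the three places: `2` and `5` of kind (i) (binders), `59` of kind (iii′) (kernel)
  set e := Rat.HeightOneSpectrum.primesEquiv (R := 𝓞 ℚ) with he
  have hcases : (e v : ℕ) = 2 ∨ (e v : ℕ) = 5 ∨ (e v : ℕ) = 59 := by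
    simp only [Finset.mem_insert, Finset.mem_singleton] at hvS
    rcases hvS with h | h | h
    · left; rw [h, he, Equiv.apply_symm_apply]
    · right; left; rw [h, he, Equiv.apply_symm_apply]
    · right; right; rw [h, he, Equiv.apply_symm_apply]
  rcases hcases with h2 | h5 | h59
  · -- `v = 2`: kind (i) IN THE KERNEL — the partner is additive `III` at `2`, `c₂ = 2`, `#Ẽ'_ns(𝔽₂) = 2`
    exact Or.inl (LocalTorsionAway.natCard_ker_nsmul_adicCompletion_eq_one_of_intModel_of_additive_tamLocal_forall
      hI' 2 5 (by norm_num) h2 (by decide) (by decide) (E := ⟨2, 1, 4, 0, 0, 0, 0, 9, 3, 2, 2⟩) rfl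
      tamLocal_check_v377600a1_2 (by decide))
  · -- `v = 5`: kind (i), BINDER (additive `IV` AT `p`: the tame-extension argument of the certificate)
    exact Or.inl (hloc5 v h5)
  · -- `v = 59`: kind (iii′) IN THE KERNEL
    exact Or.inr (kindIIIPrime_v377600_at59 _ _ rfl rfl h59)

end Summit.BirchSwinnertonDyer.Rank1Residual.X4

end
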